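import Summits.QuantumAdvantage.QuantumAdvantage.Theorems.CubicForrelationNearExactIsExactTwelveLevelFiveOffFlatC

/-!
# Crux `CubicForrelation.NearExactIsExact` (stmt-QuantumAdvantage-14043) — n = 12, level 5 in the whole window top: the pair is exact off the
  hyperplane

Certificate seat `b2b-cforr-cert` (gen 13).  HONEST FRAMING: a kernel-checked STRUCTURE THEOREM (standard axioms) about cubic Boolean pairs on
12 bits; NOT summit progress.

`tw5_off_flat_all`: cubic `f, g`, `W_g = 32u'` with an odd value, `Φ > 59/64` ⇒ `W_g = 64(−1)^f` wherever `W_g/32` is even.  With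
`window_twelve_levelFive` (both sides level 5 in the window) this confines the residual of a hypothetical pair with `59/64 < Φ < 1` to the
two hyperplanes `{W_g/32 odd}` and `{W_f/32 odd}`.

References: J. Ax (1964) / R. J. McEliece (1972); MacWilliams–Sloane (1977) Ch. 13–15.  Everything below is proved from Mathlib and the
tree; axioms are the standard three.
-/

set_option linter.dupNamespace false -- D-0017: single-problem summit ⇒ `QuantumAdvantage.QuantumAdvantage` by design

noncomputable section

namespace Summit.QuantumAdvantage.QuantumAdvantage.Theorems.CubicForrelation.NearExactIsExact

open Finset
open Literature.Computability.QuantumComplexity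
open Literature.Computability.QuantumComplexity.BuzetChailloux (bxor zeroVec bxor_bxor_cancel_left bxor_zeroVec zeroVec_bxor bxor_comm
  twist_zeroVec_right)
open Literature.Computability.QuantumComplexity.DerivativeWalsh (W)

/-- **Level 5 in the whole window top: off the hyperplane the pair is exact.**  Cubic `f, g : 𝔽₂¹² → 𝔽₂`, `W_g = 32·u'` with some
`u'(x)` odd, `Φ(f,g) > 59/64`.  Then `u' = 2(−1)^f` (i.e. `W_g = 64(−1)^f`) at every point where `u'` is even — the residual
`e = u' − 2(−1)^f` lives on the hyperplane `P = {u' odd}`.  (`16 ∣ e` off `P` by `tw5_off_flat_16`; two non-zero points would cost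
`512 > budget`; a single one, `e = ±16`, contradicts `Σ_{P^c} e = Σ_{P^c} u' − 2Σ_{P^c}(−1)^f ∈ 128ℤ + 32ℤ`, `tw5_annP` + Ax on the
hyperplane `tw5_axP`.)  Finite-slice statement; NOT summit progress. [this work] -/
theorem tw5_off_flat_all (f g : (Fin (6 + 6) → Bool) → Bool) (hf : IsDegLeFun 3 f) (hg : IsDegLeFun 3 g)
    (u' : (Fin (6 + 6) → Bool) → ℤ) (hu' : ∀ x, W (fun y => signOf (g y)) x = (2 : ℝ) ^ 5 * (u' x : ℝ))
    (hodd : ∃ x, Odd (u' x)) (hΦ : (59 / 64 : ℝ) < forrelation f g) :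
    ∀ y, ¬ Odd (u' y) → u' y = 2 * sZ (f y) := by
  classical
  -- `u = 2u'` at the Ax level `4`; residual `e = u' − 2s`, budget `B = Σ e² = 2¹⁵(1 − Φ) < 2560`
  set u : (Fin (6 + 6) → Bool) → ℤ := fun x => 2 * u' x with hudef
  have hu : ∀ x, W (fun y => signOf (g y)) x = (2 : ℝ) ^ 4 * (u x : ℝ) := by
    intro x; rw [hu' x]; simp only [u]; push_cast; ring
  set e : (Fin (6 + 6) → Bool) → ℤ := fun x => u' x - 2 * sZ (f x) with hedef
  have hbud := tw12_budget f g u hu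
  have h4e : ∀ x, (u x - 4 * sZ (f x)) ^ 2 = 4 * e x ^ 2 := fun x => by simp only [u, e]; ring
  have hBR : ((∑ x, e x ^ 2 : ℤ) : ℝ) = 32768 * (1 - forrelation f g) := by
    have h' : ((∑ x, (u x - 4 * sZ (f x)) ^ 2 : ℤ) : ℝ) = 4 * ((∑ x, e x ^ 2 : ℤ) : ℝ) := by
      rw [sum_congr rfl fun x _ => h4e x, ← mul_sum]; push_cast; ring
    rw [h'] at hbud
    linarith
  have hB_le : (∑ x, e x ^ 2 : ℤ) ≤ 2559 := by
    have h' : ((∑ x, e x ^ 2 : ℤ) : ℝ) < 2560 := by rw [hBR]; linarith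
    have h'' : (∑ x, e x ^ 2 : ℤ) < 2560 := by exact_mod_cast h'
    omega
  -- the odd set `P` of `u'` is an affine hyperplane
  have hℓ : IsDegLeFun 1 (fun x => decide (Odd (u' x))) :=
    stub_walshTower stub_axParity (6 + 6) 5 1 g u' hg hu' (by intro k hk hkn; omega)
  set P := univ.filter (fun x : Fin (6 + 6) → Bool => Odd (u' x)) with hPdef
  have hmemP : ∀ x, x ∈ P ↔ Odd (u' x) := fun x => by simp [hPdef]
  have heodd : ∀ x, x ∈ P → Odd (e x) := by
    intro x hx
    exact Int.odd_sub.2 (iff_of_true ((hmemP x).1 hx) ⟨sZ (f x), two_mul _⟩)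
  have hsq1 : ∀ x, x ∈ P → 1 ≤ e x ^ 2 := by
    intro x hx
    have h0 := Int.odd_iff.1 (heodd x hx)
    have : e x ≤ -1 ∨ 1 ≤ e x := by omega
    have := tp_sq_ge (k := 1) (by norm_num) this
    linarith
  have hsplit : (∑ x, e x ^ 2 : ℤ) = ∑ x ∈ P, e x ^ 2 + ∑ x ∈ univ.filter (fun x => x ∉ P), e x ^ 2 := by
    rw [← sum_filter_add_sum_filter_not univ (fun x => x ∈ P)]
    congr 1
    exact sum_congr (by ext x; simp) fun _ _ => rfl
  have hoff_nn : 0 ≤ ∑ x ∈ univ.filter (fun x => x ∉ P), e x ^ 2 := sum_nonneg fun x _ => sq_nonneg _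
  have hPle : (#P : ℤ) ≤ 2559 := by
    have h1 : (#P : ℤ) = ∑ x ∈ P, (1 : ℤ) := by rw [sum_const, nsmul_eq_mul, mul_one]
    have h2 : ∑ x ∈ P, (1 : ℤ) ≤ ∑ x ∈ P, e x ^ 2 := sum_le_sum fun x hx => hsq1 x hx
    linarith
  have hfilt : (univ.filter fun x : Fin (6 + 6) → Bool => decide (Odd (u' x)) = true) = P := filter_congr fun x _ => by simp
  have hPge : 2048 ≤ #P := by
    obtain ⟨x₁, hx₁⟩ := hodd
    have hRM := bb_rmWeight_holds (6 + 6) 1 (fun x => decide (Odd (u' x))) hℓ ⟨x₁, decide_eq_true hx₁⟩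
    rw [hfilt] at hRM
    norm_num at hRM
    omega
  have hPc : 2048 ≤ #(univ.filter fun x : Fin (6 + 6) → Bool => x ∉ P) := by
    have hPlt : #P < 4096 := by
      have hlt' : (#P : ℤ) < 4096 := by linarith
      exact_mod_cast hlt'
    have hne : ∃ x, x ∉ P := by
      by_contra hall
      push Not at hall
      have : #P = 4096 := by
        rw [show P = univ from eq_univ_of_forall hall, card_univ, Fintype.card_fun, Fintype.card_bool, Fintype.card_fin]; norm_num
      omega
    obtain ⟨x₂, hx₂⟩ := hne
    have hℓ' : IsDegLeFun 1 (fun x => decide (Odd (u' x)) ^^ true) := tb_isDegLeFun_xor_const hℓ true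
    have hRM := bb_rmWeight_holds (6 + 6) 1 (fun x => decide (Odd (u' x)) ^^ true) hℓ'
      ⟨x₂, by have := (hmemP x₂).not.1 hx₂; simpa using this⟩
    have hfilt' : (univ.filter fun x : Fin (6 + 6) → Bool => (decide (Odd (u' x)) ^^ true) = true) =
        univ.filter fun x : Fin (6 + 6) → Bool => x ∉ P := filter_congr fun x _ => by rw [hmemP]; simp
    rw [hfilt'] at hRM
    norm_num at hRM ⊢
    omega
  have hcardP : #P = 2048 := by
    have htot : #P + #(univ.filter fun x : Fin (6 + 6) → Bool => x ∉ P) = 4096 := by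
      have h := Finset.card_filter_add_card_filter_not (s := (univ : Finset (Fin (6 + 6) → Bool))) (fun x => x ∈ P)
      rw [card_univ, Fintype.card_fun, Fintype.card_bool, Fintype.card_fin] at h
      have e1 : (univ.filter fun x : Fin (6 + 6) → Bool => x ∈ P) = P := by ext x; simp
      rw [e1] at h
      norm_num at h
      exact h
    omega
  -- `P` is a coset of an xor-closed `V` with `2¹¹` elements
  have hmw := mw_flat_of_minweight 0 (fun x => decide (Odd (u' x))) hℓ (by rw [hfilt, hcardP]; norm_num)
  rw [hfilt] at hmw
  obtain ⟨h0, hadd, hcardV, hcoset⟩ := hmw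
  set V := univ.filter (fun a : Fin (6 + 6) → Bool => ∀ x, decide (Odd (u' (bxor x a))) = decide (Odd (u' x))) with hV
  obtain ⟨xP, hxP⟩ : P.Nonempty := card_pos.1 (by rw [hcardP]; norm_num)
  have hS : P = V.image (bxor xP) := hcoset xP (decide_eq_true ((hmemP xP).1 hxP))
  rw [hcardP] at hcardV
  have hcardV11 : #V = 2 ^ 11 := by rw [hcardV]; norm_num
  have hPV : ∀ x, x ∈ P → ∀ a ∈ V, bxor x a ∈ P := fun x hx a ha => fl1_coset_vadd hadd hS hx ha
  -- off `P`: `16 ∣ e`, and at most one non-zero point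
  have hPsum_ge : (2048 : ℤ) ≤ ∑ x ∈ P, e x ^ 2 := by
    have h1 : ∑ x ∈ P, (1 : ℤ) ≤ ∑ x ∈ P, e x ^ 2 := sum_le_sum fun x hx => hsq1 x hx
    rw [sum_const, nsmul_eq_mul, mul_one, hcardP] at h1
    exact_mod_cast h1
  have hoff_lt : ∑ x ∈ univ.filter (fun x => x ∉ P), e x ^ 2 < 512 := by linarith
  have hoff16 : ∀ y, y ∉ P → (16 : ℤ) ∣ e y :=
    tw5_off_flat_16 f g hf hg u' hu' V xP h0 hadd hcardV11 hS (by linarith)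
  intro y₀ hy₀'
  have hy₀ : y₀ ∉ P := fun h => hy₀' ((hmemP y₀).1 h)
  by_contra hne
  have hne' : e y₀ ≠ 0 := by intro h0'; apply hne; have : e y₀ = 0 := h0'; simp only [e] at this; linarith
  have hsq256 : ∀ y, y ∉ P → e y ≠ 0 → 256 ≤ e y ^ 2 := by
    intro y hy hy0
    obtain ⟨k, hk⟩ := hoff16 y hy
    have hk0 : k ≠ 0 := by rintro rfl; exact hy0 (by rw [hk]; ring)
    have : k ≤ -1 ∨ 1 ≤ k := by omega
    have := tp_sq_ge (k := 1) (by norm_num) this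
    rw [hk]; nlinarith
  -- every other point off `P` has `e = 0`
  have hothers : ∀ y, y ∉ P → y ≠ y₀ → e y = 0 := by
    intro y hy hyy
    by_contra hy0
    have h2 : e y₀ ^ 2 + e y ^ 2 ≤ ∑ x ∈ univ.filter (fun x => x ∉ P), e x ^ 2 := by
      have hsub : ({y₀, y} : Finset (Fin (6 + 6) → Bool)) ⊆ univ.filter (fun x => x ∉ P) := by
        intro z hz
        rcases mem_insert.1 hz with rfl | hz
        · exact mem_filter.2 ⟨mem_univ _, hy₀⟩
        · rw [mem_singleton.1 hz]; exact mem_filter.2 ⟨mem_univ _, hy⟩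
      have := sum_le_sum_of_subset_of_nonneg hsub (fun x _ _ => sq_nonneg (e x))
      rwa [sum_pair (Ne.symm hyy)] at this
    have := hsq256 y₀ hy₀ hne'
    have := hsq256 y hy hy0
    linarith
  -- `e(y₀) = ±16`
  have he16 : e y₀ = 16 ∨ e y₀ = -16 := by
    obtain ⟨k, hk⟩ := hoff16 y₀ hy₀
    have h1 : e y₀ ^ 2 ≤ ∑ x ∈ univ.filter (fun x => x ∉ P), e x ^ 2 :=
      single_le_sum (f := fun x => e x ^ 2) (fun x _ => sq_nonneg (e x)) (mem_filter.2 ⟨mem_univ _, hy₀⟩)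
    have h2 : e y₀ ^ 2 < 512 := by linarith
    rw [hk] at h2 ⊢
    have hk1 : k ≤ 1 := by nlinarith
    have hk2 : -1 ≤ k := by nlinarith
    have hk0 : k ≠ 0 := by rintro rfl; exact hne' (by rw [hk]; ring)
    omega
  -- `Σ_{P^c} e = e(y₀)`
  have hsumoff : ∑ x ∈ univ.filter (fun x => x ∉ P), e x = e y₀ :=
    sum_eq_single_of_mem y₀ (mem_filter.2 ⟨mem_univ _, hy₀⟩) fun x hx hxy => hothers x (mem_filter.1 hx).2 hxy
  -- `Σ_{P^c} u' ∈ 128ℤ` (inversion) and `Σ_{P^c} (−1)^f ∈ 16ℤ` (Ax on the hyperplane)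
  have h128 := tw5_annP g u' hu' (fun x => decide (Odd (u' x))) hℓ
  have hfiltF : (univ.filter fun x : Fin (6 + 6) → Bool => decide (Odd (u' x)) = false) =
      univ.filter fun x : Fin (6 + 6) → Bool => x ∉ P := filter_congr fun x _ => by rw [hmemP]; simp
  rw [hfiltF] at h128
  have hℓ' : IsDegLeFun 1 (fun x => decide (Odd (u' x)) ^^ true) := tb_isDegLeFun_xor_const hℓ true
  have h16 := (tw5_axP (fun x => decide (Odd (u' x)) ^^ true) f hℓ' hf 0).1
  have hfiltT : (univ.filter fun x : Fin (6 + 6) → Bool => (decide (Odd (u' x)) ^^ true) = true) =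
      univ.filter fun x : Fin (6 + 6) → Bool => x ∉ P := filter_congr fun x _ => by rw [hmemP]; simp
  rw [hfiltT] at h16
  have hdec : ∑ x ∈ univ.filter (fun x => x ∉ P), e x =
      ∑ x ∈ univ.filter (fun x => x ∉ P), u' x - 2 * ∑ x ∈ univ.filter (fun x => x ∉ P), sZ (f x) := by
    rw [mul_sum, ← sum_sub_distrib]
  obtain ⟨m, hm⟩ := h128
  obtain ⟨z, hz⟩ := h16
  rw [hsumoff, hm, hz] at hdec
  rcases he16 with h | h <;> rw [h] at hdec <;> omega

end Summit.QuantumAdvantage.QuantumAdvantage.Theorems.CubicForrelation.NearExactIsExact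

end
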